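import Summits.QuantumFields.BalabanUV.Beta.GAN24.WrecAtEvenHalfRowsOfNaturalWindowsSourcePairForm
import Summits.QuantumFields.BalabanUV.Beta.GAN24.SlavedDivRowsAtPin

/-!
# `BalabanUV.Beta.GAN24.WrecAtEvenHalfRowsOfWindowTheoremsCSym` — binder row G-an2-4 ∕ (CONV-C), W-slot, the (α-0) parity re-cut: **ROAD FP's D1 LITERAL OF RECORD FROM
# THE OWNER's THREE NATURAL-WINDOW THEOREMS (AS HYPOTHESES) AND (C)sym — NOTHING ELSE** (MY FILE 3 `WrecAtEvenHalfRowsOfNaturalWindows` with its four slaved slot-divergence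
# row families `Hh₁ Hh₂ Hh₁d Hh₂d` DISCHARGED by MY FILE 5′ `SlavedDivRowsAtPin.exists_slavedDivRows_three_at_pin`; G-an2-4 formalisation swarm, leaf prover
# `b2b-balaban-gan24-formalise-leaf-03`, gen 69; FILE 3c of the journal INTENT [LEAF03-G69-ONLINE] ∕ A-4)

**END-STATE TWIN (step 3 of 4; leaf-03 g70, regenerated from leaf-03's staged bytes by `gen/mk_twins.py`; recipe = road-P2 gan24-p2 g49 W-1 l.55974 ∕ offer W-2 l.56061, adopted by leaf-03 g69 W-2 l.56945):** leaf-03 g69 FILE 3c v1.1 `WrecAtEvenHalfRowsOfWindowTheoremsCSym` 28bf19630ebb19d9 RE-ROOTED on road-P2 g49 F11 `WrecAtEvenHalfRowsOfQLSourcePairForm`: the (C)sym binder `hS` ↦ the two binders `hSrc hSrcX` (per level `l ≥ 1` the leg-and-bond symmetrised `rowC` SOURCE charge is a PAIR FORM, and its CROSSED orbit sums vanish — texts byte-identical to F11's, from road-P2's `gen49/gen/mk_tower_defs.py`), import ∕ open ∕ namespace ∕ theorem name ∕ the pass-through call swapped accordingly; the original's §2 `(C) of record` variant DROPPED (no `(C)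 ⟹ hSrc` adapter is claimed). An ADDITIONAL file: the (C)sym original stands as staged ∕ filed. Discharges NOTHING of `hSrc` ∕ `hSrcX`.

NOT IN PRINT; OUR BOOKKEEPING ([folklore] composition BY NAME; 0 `def`, 0 cited facts, 0 `def … : Prop`, 0 sorry).  HONEST FRAMING (cell contract, verbatim):
«discharging `BetaPertH` makes Bałaban's UV stability UNCONDITIONAL — a real constructive-QFT result; it is NOT the continuum limit and NOT the Clay problem.»
HONEST DEPENDENCY (verbatim): «continuum YM on T⁴ ⇐ BetaPertH ∧ nine spine estimates (0/9 proved); BetaPertH ⇐ (D1) ∧ (D4) ∧ CAP+tail; G-an2-4 gates asym, D1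
and NE2/3/4.»

WHAT (`Lc` odd, `2 ≤ Lc`, `SU(N)` with `2 ≤ N`, `r = ctrOff 4 Lc`, the eight pins): **`exists_allScalesSeq_JsRowD1Pin_of_windowTheorems_CSym`** — the D1 literal
`∃ κ θ, 0 ≤ θ < 1 ∧ AllScalesSeq (j ↦ secondMoment (TbalOf Lc (JsRowD1Pin hLc N) j) μ ν) κ θ` from EXACTLY: `HW1` (= the conclusion type of the OWNER gan24-p1's part 6
`NaturalWindowH1.h1_window_of_dressed_comb` at `c := cE₂`), `HWs` (part 6b `NaturalWindowShort.short_windows_of_dressed_comb`), `HWΔ` (part 12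
`NaturalWindowDrift.drift_windows_of_dressed_comb`) and (C)sym `hS`; §2 **`…_of_windowTheorems_C`** — the same with (C) of record (`rowC_iff_CSym_three`).  READING: on the G-an2-4 side, (Q-L) IS DISCHARGED INTO THE THREE NATURAL-WINDOW THEOREMS (staged GREEN in the
OWNER's certs; their discharge of `HW1 ∕ HWs ∕ HWΔ` kernel-checked in MY probes A ∕ B); what road FP's D1 literal displays beyond them is (C)sym ALONE.  Asserts NO value of any
charge; the window theorems are HYPOTHESES here; NOTHING of (C)sym ∕ (β) discharged; NOT «W-slot closed» until parts 6 ∕ 6b ∕ 12 land; NEVER «G-an2-4 closed» as (CONV-C); NOT D1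
(ONE road-FP instance), NOT `BetaPertH`, NOT continuum, NOT Clay; not in print.  Unit `b2b-balaban-gan24-formalise-leaf-03` (gen 69), 2026-08-23.
-/

noncomputable section

open Finset
open scoped BigOperators
open Literature.MathematicalPhysics.QuantumFieldTheory
open Literature.MathematicalPhysics.QuantumFieldTheory.Balaban1983to89
open Literature.MathematicalPhysics.QuantumFieldTheory.Balaban1983to89.Beta
open B6BondElimination (unitVec)
open B12Sec2to5 (l1)
open ExpKernelCalculus (MKer)
open OneStepResolventKernel (Fib)
open OneStepKernelFamily (KInvStep TbalOf)
open RemainderConstAllScales (AllScalesSeq)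
open AveragingContoursRooted (ctrOff ctrOff_mem_box)
open WilsonVertex2Sym (wsym22)
open AffineAveraging (box toSite)
open AveragingMixedJetTables (mixFFAt)
open BalabanCompositeJets (LocStencil₂)
open Summit.QuantumFields.BalabanUV.Beta.TameKernelCalculus (trK)
open Summit.QuantumFields.BalabanUV.Beta.BorderedHessian (sgnK)
open Summit.QuantumFields.BalabanUV.Beta.HessKerDressedUnits (unitK)
open Summit.QuantumFields.BalabanUV.Beta.SecondOrderUnits (unitS₂)
open Summit.QuantumFields.BalabanUV.Beta.AxialDressingRooted (coDressKBmAt)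
open Summit.QuantumFields.BalabanUV.Beta.SpineRooted (T2RecOf T2RecAt SpureRecAt M1At)
open Summit.QuantumFields.BalabanUV.Beta.SecondOrderSocketIdentification (vh₂SAn1 vh₂SAn1_inl_inl vh₂SAn1_inr_inr)
open Summit.QuantumFields.BalabanUV.Beta.SecondOrderTableLawEnd (locStencil₂_vh₂SAn1 vh₂SAn1_translate)
open Summit.QuantumFields.BalabanUV.Beta.RowD1JointEnd (JsRowD1Pin)
open Summit.QuantumFields.BalabanUV.Beta.GAN24.CombesThomas (sfStep smStep)
open Summit.QuantumFields.BalabanUV.Beta.GAN24.BiStencilZeroMode (zmode)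
open Summit.QuantumFields.BalabanUV.Beta.GAN24.T2RecursionAffine (lin4)
open Summit.QuantumFields.BalabanUV.Beta.GAN24.RowCChargeForms (rowC_iff_CSym_three)
open Summit.QuantumFields.BalabanUV.Beta.GAN24.Lin4LegTowerUnroll (legStepB bsumPow legChain)
open Summit.QuantumFields.BalabanUV.Beta.GAN24.WrecAtEvenHalfRowsOfNaturalWindowsSourcePairForm (exists_allScalesSeq_JsRowD1Pin_of_naturalWindows_sourcePairForm)
open Summit.QuantumFields.BalabanUV.Beta.GAN24.SlavedDivRowsAtPin (exists_slavedDivRows_three_at_pin)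

namespace Summit.QuantumFields.BalabanUV.Beta.GAN24.WrecAtEvenHalfRowsOfWindowTheoremsSourcePairForm

variable {Lc : ℕ} [NeZero Lc]

/-- NOT IN PRINT; OUR BOOKKEEPING.  **ROAD FP's D1 LITERAL FROM THE THREE NATURAL-WINDOW THEOREMS (AS HYPOTHESES) AND (C)sym** — FILE 3 with `Hh₁ Hh₂ Hh₁d Hh₂d :=` FILE 5′ §2. -/
theorem exists_allScalesSeq_JsRowD1Pin_of_windowTheorems_sourcePairForm (hLc : Odd Lc) (hL2 : 2 ≤ Lc) {N : ℕ} (hN : 2 ≤ N) {r : Fin (3 + 1) → ℕ} (hr : r = ctrOff (3 + 1) Lc)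
    {cE cVH cΛ cE₂ cB : ℝ} (hcE : cE = (Lc : ℝ) ^ (3 + 1)) (hcVH : cVH = -((Lc : ℝ) ^ (3 + 1) * (1 / 2) * (Lc : ℝ) ^ (3 + 1))) (hcΛ : cΛ = 2 / (Lc : ℝ) ^ 4) (hcE₂ : cE₂ = (Lc : ℝ) ^ (2 * (3 + 1)))
    (hcB : cB = -((Lc : ℝ) ^ 12 / 4)) {Tc : Fin 4 → Fin 4 → Fin 4 → Fin 4 → ℝ} (hTc : Tc = (8 * (N : ℝ) ^ 2)⁻¹ • wsym22 N)
    {vh₂S : (Fin (3 + 1) → (Fin (3 + 1) → ℤ) → Fin (3 + 1) → (Fin (3 + 1) → ℤ) → MKer (3 + 1) (Fib 3))} (hvh : vh₂S = vh₂SAn1 Lc)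
    (HW1 : ∃ δ₁ : ℝ, 0 < δ₁ ∧ ∀ δ : ℝ, 0 < δ → δ ≤ δ₁ → ∃ kmin : ℕ, ∀ k : ℕ, kmin ≤ k →
      ∃ θ Cg : ℝ, 0 ≤ θ ∧ θ < 1 ∧ 0 ≤ Cg ∧ ∀ (rr : Fin (3 + 1) → ℕ), rr ∈ box (3 + 1) Lc →
        ∀ (n : ℕ) (W : (Fin (3 + 1) → (Fin (3 + 1) → ℤ) → Fin (3 + 1) → (Fin (3 + 1) → ℤ) → MKer (3 + 1) (Fib 3))) (C g : ℝ),
          (∃ B : ℝ, ∀ κ u κ' u' x z a b, |W κ u κ' u' x z a b| ≤ B) → LocStencil₂ W C δ →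
          (∀ (κ₁ : Fin (3 + 1)) (v : Fin (3 + 1) → ℤ) (κ₂ : Fin (3 + 1)) (x p : Fin (3 + 1) → ℤ) (f b : Fib 3),
              |∑' v', W κ₁ v κ₂ v' x p f b| ≤ g * Real.exp (-δ * (l1 (x - v) + l1 (p - v)))) →
          (∀ (κ₁ κ₂ : Fin (3 + 1)) (v' x p : Fin (3 + 1) → ℤ) (f b : Fib 3),
              |∑' v, W κ₁ v κ₂ v' x p f b| ≤ g * Real.exp (-δ * (l1 (x - v') + l1 (p - v')))) →
          (∀ (κ₁ κ₂ : Fin (3 + 1)) (x p : Fin (3 + 1) → ℤ) (f b : Fib 3),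
              |∑' v, ∑' v', W κ₁ v κ₂ v' x p f b| ≤ g * Real.exp (-δ * l1 (p - x))) →
          (∀ (κ : Fin (3 + 1)) (v w x p : Fin (3 + 1) → ℤ) (f b : Fib 3),
              |∑ μ, (W κ v μ (w - unitVec μ) x p f b - W κ v μ w x p f b)|
                ≤ g * Real.exp (-δ * l1 (w - v)) * Real.exp (-δ * (l1 (x - v) + l1 (p - v)))) →
          (∀ (κ' : Fin (3 + 1)) (w v' x p : Fin (3 + 1) → ℤ) (f b : Fib 3),
              |∑ κ, (W κ (w - unitVec κ) κ' v' x p f b - W κ w κ' v' x p f b)|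
                ≤ g * Real.exp (-δ * l1 (v' - w)) * Real.exp (-δ * (l1 (x - w) + l1 (p - w)))) →
          LocStencil₂ (legChain (fun _ : ℕ => -((cE₂ * (Lc : ℝ) ^ (2 * (3 + 1))) * ((Lc : ℝ) ^ (3 + 1))⁻¹))
              (fun m => unitK (sfStep Lc m) (smStep 3 Lc m) (coDressKBmAt (toSite rr) Lc (KInvStep (d := 3) Lc m))) Lc n (k + 1)
              (fun κ u κ' u' => bsumPow Lc (k + 1) (W κ u κ' u'))) (θ * C + Cg * g) δ)
    (HWs : ∃ κ₁ : ℝ, 0 < κ₁ ∧ ∀ δS δ : ℝ, 0 < δ → δ ≤ δS → 18 * (((3 : ℕ) : ℝ) + 1) * δ ≤ κ₁ → 108 * (((3 : ℕ) : ℝ) + 1) * δ ≤ δS * (Lc : ℝ) →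
      ∀ k₀ : ℕ, ∃ A B : ℝ, 1 ≤ A ∧ 0 ≤ B ∧ ∀ (rr : Fin (3 + 1) → ℕ), rr ∈ box (3 + 1) Lc → ∀ (p q : ℕ) (W : (Fin (3 + 1) → (Fin (3 + 1) → ℤ) → Fin (3 + 1) → (Fin (3 + 1) → ℤ) → MKer (3 + 1) (Fib 3))) (C g : ℝ), q < k₀ →
          (∃ B' : ℝ, ∀ κ u κ' u' x z a b, |W κ u κ' u' x z a b| ≤ B') → LocStencil₂ W C δS →
          (∀ (κ₁ : Fin (3 + 1)) (v : Fin (3 + 1) → ℤ) (κ₂ : Fin (3 + 1)) (x p : Fin (3 + 1) → ℤ) (f b : Fib 3),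
              |∑' v', W κ₁ v κ₂ v' x p f b| ≤ g * Real.exp (-δS * (l1 (x - v) + l1 (p - v)))) →
          (∀ (κ₁ κ₂ : Fin (3 + 1)) (v' x p : Fin (3 + 1) → ℤ) (f b : Fib 3),
              |∑' v, W κ₁ v κ₂ v' x p f b| ≤ g * Real.exp (-δS * (l1 (x - v') + l1 (p - v')))) →
          (∀ (κ₁ κ₂ : Fin (3 + 1)) (x p : Fin (3 + 1) → ℤ) (f b : Fib 3),
              |∑' v, ∑' v', W κ₁ v κ₂ v' x p f b| ≤ g * Real.exp (-δS * l1 (p - x))) →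
          (∀ (κ : Fin (3 + 1)) (v w x p : Fin (3 + 1) → ℤ) (f b : Fib 3),
              |∑ μ, (W κ v μ (w - unitVec μ) x p f b - W κ v μ w x p f b)|
                ≤ g * Real.exp (-δS * l1 (w - v)) * Real.exp (-δS * (l1 (x - v) + l1 (p - v)))) →
          (∀ (κ' : Fin (3 + 1)) (w v' x p : Fin (3 + 1) → ℤ) (f b : Fib 3),
              |∑ κ, (W κ (w - unitVec κ) κ' v' x p f b - W κ w κ' v' x p f b)|
                ≤ g * Real.exp (-δS * l1 (v' - w)) * Real.exp (-δS * (l1 (x - w) + l1 (p - w)))) →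
          LocStencil₂ (legChain (fun _ : ℕ => -((cE₂ * (Lc : ℝ) ^ (2 * (3 + 1))) * ((Lc : ℝ) ^ (3 + 1))⁻¹))
              (fun m => unitK (sfStep Lc m) (smStep 3 Lc m) (coDressKBmAt (toSite rr) Lc (KInvStep (d := 3) Lc m))) Lc p q
              (fun κ u κ' u' => bsumPow Lc q (W κ u κ' u'))) (A * C + B * g) δ)
    (HWΔ : ∃ κΔ ν : ℝ, 0 < κΔ ∧ 0 ≤ ν ∧ ν < 1 ∧ ∀ δ δD : ℝ, 0 < δD → δD ≤ δ → 18 * (((3 : ℕ) : ℝ) + 1) * δD ≤ κΔ → 108 * (((3 : ℕ) : ℝ) + 1) * δD ≤ δ * (Lc : ℝ) →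
      ∀ k₀ : ℕ, ∃ AΔ BΔ : ℝ, 0 ≤ AΔ ∧ 0 ≤ BΔ ∧ ∀ (rr : Fin (3 + 1) → ℕ), rr ∈ box (3 + 1) Lc → ∀ (l q : ℕ) (W : (Fin (3 + 1) → (Fin (3 + 1) → ℤ) → Fin (3 + 1) → (Fin (3 + 1) → ℤ) → MKer (3 + 1) (Fib 3))) (C g : ℝ), q < k₀ →
          (∃ B : ℝ, ∀ κ u κ' u' x z a b, |W κ u κ' u' x z a b| ≤ B) → LocStencil₂ W C δ →
          (∀ (κ₁ : Fin (3 + 1)) (v : Fin (3 + 1) → ℤ) (κ₂ : Fin (3 + 1)) (x p : Fin (3 + 1) → ℤ) (f b : Fib 3),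
              |∑' v', W κ₁ v κ₂ v' x p f b| ≤ g * Real.exp (-δ * (l1 (x - v) + l1 (p - v)))) →
          (∀ (κ₁ κ₂ : Fin (3 + 1)) (v' x p : Fin (3 + 1) → ℤ) (f b : Fib 3),
              |∑' v, W κ₁ v κ₂ v' x p f b| ≤ g * Real.exp (-δ * (l1 (x - v') + l1 (p - v')))) →
          (∀ (κ₁ κ₂ : Fin (3 + 1)) (x p : Fin (3 + 1) → ℤ) (f b : Fib 3),
              |∑' v, ∑' v', W κ₁ v κ₂ v' x p f b| ≤ g * Real.exp (-δ * l1 (p - x))) →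
          (∀ (κ : Fin (3 + 1)) (v w x p : Fin (3 + 1) → ℤ) (f b : Fib 3),
              |∑ μ, (W κ v μ (w - unitVec μ) x p f b - W κ v μ w x p f b)|
                ≤ g * Real.exp (-δ * l1 (w - v)) * Real.exp (-δ * (l1 (x - v) + l1 (p - v)))) →
          (∀ (κ' : Fin (3 + 1)) (w v' x p : Fin (3 + 1) → ℤ) (f b : Fib 3),
              |∑ κ, (W κ (w - unitVec κ) κ' v' x p f b - W κ w κ' v' x p f b)|
                ≤ g * Real.exp (-δ * l1 (v' - w)) * Real.exp (-δ * (l1 (x - w) + l1 (p - w)))) →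
          LocStencil₂ (legChain (fun _ : ℕ => -((cE₂ * (Lc : ℝ) ^ (2 * (3 + 1))) * ((Lc : ℝ) ^ (3 + 1))⁻¹))
              (fun m => unitK (sfStep Lc m) (smStep 3 Lc m) (coDressKBmAt (toSite rr) Lc (KInvStep (d := 3) Lc m))) Lc (l + 2) q
              (fun κ u κ' u' => bsumPow Lc q ((legStepB (fun _ : ℕ => -((cE₂ * (Lc : ℝ) ^ (2 * (3 + 1))) * ((Lc : ℝ) ^ (3 + 1))⁻¹))
                  (fun m => unitK (sfStep Lc m) (smStep 3 Lc m) (coDressKBmAt (toSite rr) Lc (KInvStep (d := 3) Lc m))) Lc (l + 1) W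
                - legStepB (fun _ : ℕ => -((cE₂ * (Lc : ℝ) ^ (2 * (3 + 1))) * ((Lc : ℝ) ^ (3 + 1))⁻¹))
                  (fun m => unitK (sfStep Lc m) (smStep 3 Lc m) (coDressKBmAt (toSite rr) Lc (KInvStep (d := 3) Lc m))) Lc l W) κ u κ' u'))) ((AΔ * C + BΔ * g) * ν ^ l) δD)
    (hSrc : ∀ l : ℕ, ∃ S : Fin (3 + 1) → Fin (3 + 1) → Fin (3 + 1) → Fin (3 + 1) → ℝ,
      (∀ a b c e, S b a c e = -S a b c e) ∧ (∀ a b c e, S a b e c = -S a b c e) ∧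
      ∀ κ κ' κ₁ κ₂ : Fin (3 + 1),
      (zmode Lc ((unitS₂ (sfStep Lc ((l + 1) + 1)) (smStep 3 Lc ((l + 1) + 1)) (T2RecAt 3 Lc (toSite r) cE cVH cΛ cE₂ cB Tc vh₂S (mixFFAt (toSite r) Lc) ((l + 1) + 1)))
             - lin4 (cE₂ * (Lc : ℝ) ^ (2 * (3 + 1))) (unitK (sfStep Lc (l + 1)) (smStep 3 Lc (l + 1)) (KInvStep (d := 3) Lc (l + 1))) Lc
               (unitS₂ (sfStep Lc (l + 1)) (smStep 3 Lc (l + 1)) (T2RecAt 3 Lc (toSite r) cE cVH cΛ cE₂ cB Tc vh₂S (mixFFAt (toSite r) Lc) (l + 1)))) κ κ' (Sum.inl κ₁) (Sum.inl κ₂)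
         + zmode Lc ((unitS₂ (sfStep Lc ((l + 1) + 1)) (smStep 3 Lc ((l + 1) + 1)) (T2RecAt 3 Lc (toSite r) cE cVH cΛ cE₂ cB Tc vh₂S (mixFFAt (toSite r) Lc) ((l + 1) + 1)))
             - lin4 (cE₂ * (Lc : ℝ) ^ (2 * (3 + 1))) (unitK (sfStep Lc (l + 1)) (smStep 3 Lc (l + 1)) (KInvStep (d := 3) Lc (l + 1))) Lc
               (unitS₂ (sfStep Lc (l + 1)) (smStep 3 Lc (l + 1)) (T2RecAt 3 Lc (toSite r) cE cVH cΛ cE₂ cB Tc vh₂S (mixFFAt (toSite r) Lc) (l + 1)))) κ' κ (Sum.inl κ₁) (Sum.inl κ₂))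
      + (zmode Lc ((unitS₂ (sfStep Lc ((l + 1) + 1)) (smStep 3 Lc ((l + 1) + 1)) (T2RecAt 3 Lc (toSite r) cE cVH cΛ cE₂ cB Tc vh₂S (mixFFAt (toSite r) Lc) ((l + 1) + 1)))
             - lin4 (cE₂ * (Lc : ℝ) ^ (2 * (3 + 1))) (unitK (sfStep Lc (l + 1)) (smStep 3 Lc (l + 1)) (KInvStep (d := 3) Lc (l + 1))) Lc
               (unitS₂ (sfStep Lc (l + 1)) (smStep 3 Lc (l + 1)) (T2RecAt 3 Lc (toSite r) cE cVH cΛ cE₂ cB Tc vh₂S (mixFFAt (toSite r) Lc) (l + 1)))) κ κ' (Sum.inl κ₂) (Sum.inl κ₁)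
         + zmode Lc ((unitS₂ (sfStep Lc ((l + 1) + 1)) (smStep 3 Lc ((l + 1) + 1)) (T2RecAt 3 Lc (toSite r) cE cVH cΛ cE₂ cB Tc vh₂S (mixFFAt (toSite r) Lc) ((l + 1) + 1)))
             - lin4 (cE₂ * (Lc : ℝ) ^ (2 * (3 + 1))) (unitK (sfStep Lc (l + 1)) (smStep 3 Lc (l + 1)) (KInvStep (d := 3) Lc (l + 1))) Lc
               (unitS₂ (sfStep Lc (l + 1)) (smStep 3 Lc (l + 1)) (T2RecAt 3 Lc (toSite r) cE cVH cΛ cE₂ cB Tc vh₂S (mixFFAt (toSite r) Lc) (l + 1)))) κ' κ (Sum.inl κ₂) (Sum.inl κ₁))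
        = S κ κ₁ κ' κ₂ + S κ' κ₁ κ κ₂ + (S κ κ₂ κ' κ₁ + S κ' κ₂ κ κ₁))
    (hSrcX : ∀ (l : ℕ) (a b : Fin (3 + 1)), a ≠ b →
      (zmode Lc ((unitS₂ (sfStep Lc ((l + 1) + 1)) (smStep 3 Lc ((l + 1) + 1)) (T2RecAt 3 Lc (toSite r) cE cVH cΛ cE₂ cB Tc vh₂S (mixFFAt (toSite r) Lc) ((l + 1) + 1)))
             - lin4 (cE₂ * (Lc : ℝ) ^ (2 * (3 + 1))) (unitK (sfStep Lc (l + 1)) (smStep 3 Lc (l + 1)) (KInvStep (d := 3) Lc (l + 1))) Lc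
               (unitS₂ (sfStep Lc (l + 1)) (smStep 3 Lc (l + 1)) (T2RecAt 3 Lc (toSite r) cE cVH cΛ cE₂ cB Tc vh₂S (mixFFAt (toSite r) Lc) (l + 1)))) a b (Sum.inl a) (Sum.inl b)
         + zmode Lc ((unitS₂ (sfStep Lc ((l + 1) + 1)) (smStep 3 Lc ((l + 1) + 1)) (T2RecAt 3 Lc (toSite r) cE cVH cΛ cE₂ cB Tc vh₂S (mixFFAt (toSite r) Lc) ((l + 1) + 1)))
             - lin4 (cE₂ * (Lc : ℝ) ^ (2 * (3 + 1))) (unitK (sfStep Lc (l + 1)) (smStep 3 Lc (l + 1)) (KInvStep (d := 3) Lc (l + 1))) Lc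
               (unitS₂ (sfStep Lc (l + 1)) (smStep 3 Lc (l + 1)) (T2RecAt 3 Lc (toSite r) cE cVH cΛ cE₂ cB Tc vh₂S (mixFFAt (toSite r) Lc) (l + 1)))) b a (Sum.inl a) (Sum.inl b))
      + (zmode Lc ((unitS₂ (sfStep Lc ((l + 1) + 1)) (smStep 3 Lc ((l + 1) + 1)) (T2RecAt 3 Lc (toSite r) cE cVH cΛ cE₂ cB Tc vh₂S (mixFFAt (toSite r) Lc) ((l + 1) + 1)))
             - lin4 (cE₂ * (Lc : ℝ) ^ (2 * (3 + 1))) (unitK (sfStep Lc (l + 1)) (smStep 3 Lc (l + 1)) (KInvStep (d := 3) Lc (l + 1))) Lc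
               (unitS₂ (sfStep Lc (l + 1)) (smStep 3 Lc (l + 1)) (T2RecAt 3 Lc (toSite r) cE cVH cΛ cE₂ cB Tc vh₂S (mixFFAt (toSite r) Lc) (l + 1)))) a b (Sum.inl b) (Sum.inl a)
         + zmode Lc ((unitS₂ (sfStep Lc ((l + 1) + 1)) (smStep 3 Lc ((l + 1) + 1)) (T2RecAt 3 Lc (toSite r) cE cVH cΛ cE₂ cB Tc vh₂S (mixFFAt (toSite r) Lc) ((l + 1) + 1)))
             - lin4 (cE₂ * (Lc : ℝ) ^ (2 * (3 + 1))) (unitK (sfStep Lc (l + 1)) (smStep 3 Lc (l + 1)) (KInvStep (d := 3) Lc (l + 1))) Lc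
               (unitS₂ (sfStep Lc (l + 1)) (smStep 3 Lc (l + 1)) (T2RecAt 3 Lc (toSite r) cE cVH cΛ cE₂ cB Tc vh₂S (mixFFAt (toSite r) Lc) (l + 1)))) b a (Sum.inl b) (Sum.inl a)) = 0)
    (μ ν' : Fin 4) :
    ∃ κ θ' : ℝ, 0 ≤ θ' ∧ θ' < 1 ∧ AllScalesSeq (fun j => B12Beta.secondMoment (TbalOf Lc (JsRowD1Pin hLc N) j) μ ν') κ θ' := by
  obtain ⟨δ₃, σ₁, σ₂, σ₁d, σ₂d, ν₃, hδ₃, hν₃0, hν₃1, Hh₁, Hh₂, Hh₁d, Hh₂d⟩ :=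
    exists_slavedDivRows_three_at_pin hLc hL2 hN hr hcE hcVH hcΛ hcE₂ hcB hTc hvh
  exact exists_allScalesSeq_JsRowD1Pin_of_naturalWindows_sourcePairForm hLc hL2 hN hr hcE hcVH hcΛ hcE₂ hcB hTc hvh HW1 HWs HWΔ
    hδ₃ hν₃0 hν₃1 Hh₁ Hh₂ Hh₁d Hh₂d hSrc hSrcX μ ν'

end Summit.QuantumFields.BalabanUV.Beta.GAN24.WrecAtEvenHalfRowsOfWindowTheoremsSourcePairForm

end
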